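import Mathlib.Algebra.Order.Field.Basic
import Mathlib.Algebra.Order.AbsoluteValue.Basic
import Mathlib.Data.Finset.Max
import Mathlib.Data.Nat.Cast.Order.Basic
import Mathlib.Tactic.Linarith
import Mathlib.Tactic.NormNum
import HarnessLib

/-!
# MX scale selection: the nesting structure behind the two-candidate window (OPTIMA.md §S, S1–S2)

HONEST FRAMING: certified error envelopes and provably optimal rounding/accumulation schemes for
low-precision formats under stated cost models; every table by two implementations; no hardware or
vendor claims.

Venture CertifiedArithmetic / lowprec, OPT slice (staged under the cell HOME until the venture path
class opens at the gate).  New work, not literature.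

The quantiser at scale `t` maps `x ≥ 0` to a nearest point of the scaled magnitude grid `t·G`
(saturating above the top, which is again the nearest point), so its error is exactly the DISTANCE
`gridDist (t·G) x`.  Everything in OPTIMA.md Theorems S3–S8 rests on two facts about the pair of scales
`(t, t/2)`:

* **Domination principle** (`gridDist_mono_of_forall`): if every point of grid `A` is matched by a point
  of grid `B` at least as close to `y`, then `dist(y,B) ≤ dist(y,A)`.  Its corollary
  `gridDist_mono_of_nested_below_cut` is Lemma S2(i): if `B ⊇ A ∩ [0,c]`, `c ∈ B` and `y ≤ c`, then
  `dist(y,B) ≤ dist(y,A)` — halving the scale never hurts an element below the lower scale's clip point.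
* **Nesting / refinement / coincidence** (Lemma S1) for the concrete OCP element formats E2M1, E2M3, E3M2,
  as decidable statements about the integer grids `Hi = t·G` and `Lo = (t/2)·G` in units of
  `t·2^(emin-m-1)` (so both are sets of naturals; the literals below are generated from FORMATS.md and
  re-derived independently in `code/opt/mxscale_impl_{a,b}.py`, certificate C1):
  `Hi ∩ [0, clipLo] ⊆ Lo` (nesting), `Lo \ Hi ⊆ [0, minNormalHi)` (refinement points all lie below the
  smallest normal of the upper grid), and `Lo = Hi` on `[minNormalHi, clipLo]` (coincidence zone).
  The instantiated real-field statement `e2m1_halving_le` etc. is S2(i) for that format.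
-/

namespace Summit.Ventures.CertifiedArithmetic.LowPrec.Opt

/-! ### Abstract part: distance to a finite grid -/

section Abstract

variable {K : Type*} [Field K] [LinearOrder K] [IsStrictOrderedRing K]

/-- Distance from `y` to the nonempty finite grid `S`. For a round-to-nearest (saturating) quantiser onto
`S` this is exactly the absolute quantisation error. -/
def gridDist (S : Finset K) (hS : S.Nonempty) (y : K) : K := S.inf' hS (fun v => |y - v|)

omit [IsStrictOrderedRing K] in
/-- The grid distance is at most the distance to any particular grid point. -/
theorem gridDist_le_of_mem {S : Finset K} (hS : S.Nonempty) {y v : K} (hv : v ∈ S) :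
    gridDist S hS y ≤ |y - v| := Finset.inf'_le _ hv

/-- The grid distance is nonnegative. -/
theorem gridDist_nonneg {S : Finset K} (hS : S.Nonempty) (y : K) : 0 ≤ gridDist S hS y := by
  obtain ⟨v, _, h⟩ := Finset.exists_mem_eq_inf' hS (fun v => |y - v|)
  rw [gridDist, h]; exact abs_nonneg _

/-- A grid point has grid distance zero (representable values are quantised exactly). -/
theorem gridDist_eq_zero_of_mem {S : Finset K} (hS : S.Nonempty) {y : K} (hy : y ∈ S) :
    gridDist S hS y = 0 :=
  le_antisymm (by simpa using gridDist_le_of_mem hS (y := y) hy) (gridDist_nonneg hS y)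

omit [IsStrictOrderedRing K] in
/-- **Domination principle.** If every point of `A` is matched by a point of `B` at least as close to `y`,
then the distance to `B` is at most the distance to `A`. -/
theorem gridDist_mono_of_forall {A B : Finset K} (hA : A.Nonempty) (hB : B.Nonempty) {y : K}
    (h : ∀ a ∈ A, ∃ b ∈ B, |y - b| ≤ |y - a|) : gridDist B hB y ≤ gridDist A hA y := by
  apply Finset.le_inf'
  intro a ha
  obtain ⟨b, hb, hle⟩ := h a ha
  exact (Finset.inf'_le _ hb).trans hle

omit [IsStrictOrderedRing K] in
/-- A finer grid (superset) is never worse. -/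
theorem gridDist_mono_of_subset {A B : Finset K} (hA : A.Nonempty) (hB : B.Nonempty) (hAB : A ⊆ B)
    (y : K) : gridDist B hB y ≤ gridDist A hA y :=
  gridDist_mono_of_forall hA hB (fun a ha => ⟨a, hAB ha, le_rfl⟩)

/-- **Lemma S2(i) (nested below a cut).** If `B` contains every point of `A` that is `≤ c`, contains `c`
itself, and `y ≤ c`, then `dist(y,B) ≤ dist(y,A)`: points of `A` above `c` are never closer to `y` than
`c` is. With `A = t·G`, `B = (t/2)·G`, `c` = the clip point `(t/2)·M` this is "halving the scale never
increases the error of an element below the lower clip point". -/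
theorem gridDist_mono_of_nested_below_cut {A B : Finset K} (hA : A.Nonempty) (hB : B.Nonempty)
    {c y : K} (hc : c ∈ B) (hyc : y ≤ c) (hnest : ∀ a ∈ A, a ≤ c → a ∈ B) :
    gridDist B hB y ≤ gridDist A hA y := by
  refine gridDist_mono_of_forall hA hB (fun a ha => ?_)
  by_cases hac : a ≤ c
  · exact ⟨a, hnest a ha hac, le_rfl⟩
  · refine ⟨c, hc, ?_⟩
    have hca : c < a := lt_of_not_ge hac
    rw [abs_of_nonpos (by linarith), abs_of_nonpos (by linarith)]
    linarith

/-- **Lemma S2(iii) engine (coincidence).** If `A` and `B` have the same points on `[l, c]`, both contain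
`l` and `c`, and `l ≤ y ≤ c`, then the two distances agree. -/
theorem gridDist_eq_of_coincide {A B : Finset K} (hA : A.Nonempty) (hB : B.Nonempty) {l c y : K}
    (hlA : l ∈ A) (hcA : c ∈ A) (hlB : l ∈ B) (hcB : c ∈ B) (hly : l ≤ y) (hyc : y ≤ c)
    (hAB : ∀ a ∈ A, l ≤ a → a ≤ c → a ∈ B) (hBA : ∀ b ∈ B, l ≤ b → b ≤ c → b ∈ A) :
    gridDist A hA y = gridDist B hB y := by
  apply le_antisymm
  · refine gridDist_mono_of_forall hB hA (fun b hb => ?_)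
    by_cases h1 : l ≤ b
    · by_cases h2 : b ≤ c
      · exact ⟨b, hBA b hb h1 h2, le_rfl⟩
      · have h2 : c < b := lt_of_not_ge h2
        refine ⟨c, hcA, ?_⟩
        rw [abs_of_nonpos (by linarith), abs_of_nonpos (by linarith)]; linarith
    · have h1 : b < l := lt_of_not_ge h1
      refine ⟨l, hlA, ?_⟩
      rw [abs_of_nonneg (by linarith), abs_of_nonneg (by linarith)]; linarith
  · refine gridDist_mono_of_forall hA hB (fun a ha => ?_)
    by_cases h1 : l ≤ a
    · by_cases h2 : a ≤ c
      · exact ⟨a, hAB a ha h1 h2, le_rfl⟩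
      · have h2 : c < a := lt_of_not_ge h2
        refine ⟨c, hcB, ?_⟩
        rw [abs_of_nonpos (by linarith), abs_of_nonpos (by linarith)]; linarith
    · have h1 : a < l := lt_of_not_ge h1
      refine ⟨l, hlB, ?_⟩
      rw [abs_of_nonneg (by linarith), abs_of_nonneg (by linarith)]; linarith

end Abstract

/-! ### Concrete part: the OCP element grids at scales `t` (Hi) and `t/2` (Lo), integer units -/

/-- E2M1 magnitudes `{0,½,1,1½,2,3,4,6}·t` in units `t/4`. -/
def e2m1Hi : Finset ℕ := {0, 2, 4, 6, 8, 12, 16, 24}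
/-- E2M1 magnitudes at scale `t/2`, same units. Clip point `12`, smallest normal of `Hi` is `4`. -/
def e2m1Lo : Finset ℕ := {0, 1, 2, 3, 4, 6, 8, 12}

/-- E2M1 nesting (Lemma S1(a)): every upper-grid point below the lower clip point `12` is a lower-grid point. -/
theorem e2m1_nesting : ∀ a ∈ e2m1Hi, a ≤ 12 → a ∈ e2m1Lo := by decide
/-- E2M1 refinement (Lemma S1(b)): the points the half scale adds all lie below the smallest normal `4` of the upper grid. -/
theorem e2m1_refinement : ∀ b ∈ e2m1Lo, b ∉ e2m1Hi → b < 4 := by decide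
/-- E2M1 coincidence zone `[4,12]`, lower-to-upper direction (Lemma S1(d)). -/
theorem e2m1_coincide_lo : ∀ b ∈ e2m1Lo, 4 ≤ b → b ≤ 12 → b ∈ e2m1Hi := by decide
/-- E2M1 coincidence zone `[4,12]`, upper-to-lower direction (Lemma S1(d)). -/
theorem e2m1_coincide_hi : ∀ a ∈ e2m1Hi, 4 ≤ a → a ≤ 12 → a ∈ e2m1Lo := by decide
/-- the half clip point `M/2 = 3·t` (= 12 units) is a grid point of BOTH scales (used in Thm S3/S5). -/
theorem e2m1_halfclip_mem : 12 ∈ e2m1Hi ∧ 12 ∈ e2m1Lo := by decide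

/-- E2M3 magnitudes (sub-normals `k/8`, normals up to `7.5`) at scale `t` in units `t/16`. -/
def e2m3Hi : Finset ℕ := {0, 2, 4, 6, 8, 10, 12, 14, 16, 18, 20, 22, 24, 26, 28, 30, 32, 36, 40, 44,
  48, 52, 56, 60, 64, 72, 80, 88, 96, 104, 112, 120}
/-- E2M3 magnitudes at scale `t/2`, units `t/16`. Clip point `60`, smallest normal of `Hi` is `16`. -/
def e2m3Lo : Finset ℕ := {0, 1, 2, 3, 4, 5, 6, 7, 8, 9, 10, 11, 12, 13, 14, 15, 16, 18, 20, 22, 24,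
  26, 28, 30, 32, 36, 40, 44, 48, 52, 56, 60}

/-- E2M3 nesting (Lemma S1(a)): every upper-grid point below the lower clip point `60` is a lower-grid point. -/
theorem e2m3_nesting : ∀ a ∈ e2m3Hi, a ≤ 60 → a ∈ e2m3Lo := by decide
/-- E2M3 refinement (Lemma S1(b)): the points the half scale adds all lie below the smallest normal `16` of the upper grid. -/
theorem e2m3_refinement : ∀ b ∈ e2m3Lo, b ∉ e2m3Hi → b < 16 := by decide
/-- E2M3 coincidence zone `[16,60]`, lower-to-upper direction. -/
theorem e2m3_coincide_lo : ∀ b ∈ e2m3Lo, 16 ≤ b → b ≤ 60 → b ∈ e2m3Hi := by decide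
/-- E2M3 coincidence zone `[16,60]`, upper-to-lower direction. -/
theorem e2m3_coincide_hi : ∀ a ∈ e2m3Hi, 16 ≤ a → a ≤ 60 → a ∈ e2m3Lo := by decide
/-- E2M3: the half clip point `60` (= `3.75 t`) is a grid point of both scales. -/
theorem e2m3_halfclip_mem : 60 ∈ e2m3Hi ∧ 60 ∈ e2m3Lo := by decide

/-- E3M2 magnitudes (sub-normals `k/16`, normals `(1+k/4)·2^e`, `e = -2..4`, top `28`) at scale `t`,
units `t/32`. -/
def e3m2Hi : Finset ℕ := {0, 2, 4, 6, 8, 10, 12, 14, 16, 20, 24, 28, 32, 40, 48, 56, 64, 80, 96, 112,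
  128, 160, 192, 224, 256, 320, 384, 448, 512, 640, 768, 896}
/-- E3M2 magnitudes at scale `t/2`, units `t/32`. Clip point `448`, smallest normal of `Hi` is `8`. -/
def e3m2Lo : Finset ℕ := {0, 1, 2, 3, 4, 5, 6, 7, 8, 10, 12, 14, 16, 20, 24, 28, 32, 40, 48, 56, 64,
  80, 96, 112, 128, 160, 192, 224, 256, 320, 384, 448}

/-- E3M2 nesting (Lemma S1(a)): every upper-grid point below the lower clip point `448` is a lower-grid point. -/
theorem e3m2_nesting : ∀ a ∈ e3m2Hi, a ≤ 448 → a ∈ e3m2Lo := by decide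
/-- E3M2 refinement (Lemma S1(b)): the points the half scale adds all lie below the smallest normal `8` of the upper grid. -/
theorem e3m2_refinement : ∀ b ∈ e3m2Lo, b ∉ e3m2Hi → b < 8 := by decide
/-- E3M2 coincidence zone `[8,448]`, lower-to-upper direction. -/
theorem e3m2_coincide_lo : ∀ b ∈ e3m2Lo, 8 ≤ b → b ≤ 448 → b ∈ e3m2Hi := by decide
/-- E3M2 coincidence zone `[8,448]`, upper-to-lower direction. -/
theorem e3m2_coincide_hi : ∀ a ∈ e3m2Hi, 8 ≤ a → a ≤ 448 → a ∈ e3m2Lo := by decide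
/-- E3M2: the half clip point `448` (= `14 t`) is a grid point of both scales. -/
theorem e3m2_halfclip_mem : 448 ∈ e3m2Hi ∧ 448 ∈ e3m2Lo := by decide

/-! ### Instantiation in an ordered field: Lemma S2(i) and S2(iii) for the three formats -/

section Instances

variable {K : Type*} [Field K] [LinearOrder K] [IsStrictOrderedRing K]

/-- cast an integer grid into the field -/
def castGrid (S : Finset ℕ) : Finset K := S.image (Nat.cast : ℕ → K)

omit [IsStrictOrderedRing K] in
/-- A nonempty integer grid casts to a nonempty grid. -/
theorem castGrid_nonempty {S : Finset ℕ} (h : S.Nonempty) : (castGrid S : Finset K).Nonempty :=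
  h.image _

omit [IsStrictOrderedRing K] in
/-- Membership transfers along the cast. -/
theorem mem_castGrid {S : Finset ℕ} {n : ℕ} (h : n ∈ S) : (n : K) ∈ (castGrid S : Finset K) :=
  Finset.mem_image.mpr ⟨n, h, rfl⟩

/-- generic transfer of an integer nesting fact to the field -/
theorem halving_le_of_nesting {Hi Lo : Finset ℕ} (hHi : Hi.Nonempty) (hLo : Lo.Nonempty) {c : ℕ}
    (hc : c ∈ Lo) (hnest : ∀ a ∈ Hi, a ≤ c → a ∈ Lo) {y : K} (hy : y ≤ c) :
    gridDist (castGrid Lo) (castGrid_nonempty hLo) y ≤ gridDist (castGrid Hi) (castGrid_nonempty hHi) y := by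
  refine gridDist_mono_of_nested_below_cut _ _ (mem_castGrid hc) hy ?_
  intro a ha hac
  obtain ⟨n, hn, rfl⟩ := Finset.mem_image.mp ha
  exact mem_castGrid (hnest n hn (by exact_mod_cast hac))

/-- generic transfer of an integer coincidence fact to the field -/
theorem halving_eq_of_coincide {Hi Lo : Finset ℕ} (hHi : Hi.Nonempty) (hLo : Lo.Nonempty) {l c : ℕ}
    (hlHi : l ∈ Hi) (hcHi : c ∈ Hi) (hlLo : l ∈ Lo) (hcLo : c ∈ Lo)
    (hHL : ∀ a ∈ Hi, l ≤ a → a ≤ c → a ∈ Lo) (hLH : ∀ b ∈ Lo, l ≤ b → b ≤ c → b ∈ Hi)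
    {y : K} (hly : (l : K) ≤ y) (hyc : y ≤ c) :
    gridDist (castGrid Hi) (castGrid_nonempty hHi) y = gridDist (castGrid Lo) (castGrid_nonempty hLo) y := by
  refine gridDist_eq_of_coincide _ _ (mem_castGrid hlHi) (mem_castGrid hcHi) (mem_castGrid hlLo)
    (mem_castGrid hcLo) hly hyc ?_ ?_
  · intro a ha h1 h2
    obtain ⟨n, hn, rfl⟩ := Finset.mem_image.mp ha
    exact mem_castGrid (hHL n hn (by exact_mod_cast h1) (by exact_mod_cast h2))
  · intro b hb h1 h2
    obtain ⟨n, hn, rfl⟩ := Finset.mem_image.mp hb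
    exact mem_castGrid (hLH n hn (by exact_mod_cast h1) (by exact_mod_cast h2))

/-- **S2(i) for E2M1**: below the lower clip point (`12` units = `3t`), the half scale is never worse. -/
theorem e2m1_halving_le {y : K} (hy : y ≤ 12) :
    gridDist (castGrid e2m1Lo) (castGrid_nonempty ⟨0, by decide⟩) y ≤
      gridDist (castGrid e2m1Hi) (castGrid_nonempty ⟨0, by decide⟩) y :=
  halving_le_of_nesting ⟨0, by decide⟩ ⟨0, by decide⟩ (by decide) e2m1_nesting (by exact_mod_cast hy)

/-- **S2(iii) for E2M1**: on the coincidence zone `[4, 12]` (= `[t, 3t]`) both scales give the same error. -/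
theorem e2m1_halving_eq {y : K} (hly : 4 ≤ y) (hyc : y ≤ 12) :
    gridDist (castGrid e2m1Hi) (castGrid_nonempty ⟨0, by decide⟩) y =
      gridDist (castGrid e2m1Lo) (castGrid_nonempty ⟨0, by decide⟩) y :=
  halving_eq_of_coincide ⟨0, by decide⟩ ⟨0, by decide⟩ (by decide) (by decide) (by decide) (by decide) e2m1_coincide_hi
    e2m1_coincide_lo (by exact_mod_cast hly) (by exact_mod_cast hyc)

/-- **S2(i) for E2M3**: below the lower clip point (`60` units = `3.75 t`) the half scale is never worse. -/
theorem e2m3_halving_le {y : K} (hy : y ≤ 60) :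
    gridDist (castGrid e2m3Lo) (castGrid_nonempty ⟨0, by decide⟩) y ≤
      gridDist (castGrid e2m3Hi) (castGrid_nonempty ⟨0, by decide⟩) y :=
  halving_le_of_nesting ⟨0, by decide⟩ ⟨0, by decide⟩ (by decide) e2m3_nesting (by exact_mod_cast hy)

/-- **S2(iii) for E2M3**: on the coincidence zone `[16, 60]` (= `[t, 3.75 t]`) both scales give the same error. -/
theorem e2m3_halving_eq {y : K} (hly : 16 ≤ y) (hyc : y ≤ 60) :
    gridDist (castGrid e2m3Hi) (castGrid_nonempty ⟨0, by decide⟩) y =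
      gridDist (castGrid e2m3Lo) (castGrid_nonempty ⟨0, by decide⟩) y :=
  halving_eq_of_coincide ⟨0, by decide⟩ ⟨0, by decide⟩ (by decide) (by decide) (by decide) (by decide) e2m3_coincide_hi
    e2m3_coincide_lo (by exact_mod_cast hly) (by exact_mod_cast hyc)

/-- **S2(i) for E3M2**: below the lower clip point (`448` units = `14 t`) the half scale is never worse. -/
theorem e3m2_halving_le {y : K} (hy : y ≤ 448) :
    gridDist (castGrid e3m2Lo) (castGrid_nonempty ⟨0, by decide⟩) y ≤
      gridDist (castGrid e3m2Hi) (castGrid_nonempty ⟨0, by decide⟩) y :=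
  halving_le_of_nesting ⟨0, by decide⟩ ⟨0, by decide⟩ (by decide) e3m2_nesting (by exact_mod_cast hy)

/-- **S2(iii) for E3M2**: on the coincidence zone `[8, 448]` (= `[t/4, 14 t]`) both scales give the same error. -/
theorem e3m2_halving_eq {y : K} (hly : 8 ≤ y) (hyc : y ≤ 448) :
    gridDist (castGrid e3m2Hi) (castGrid_nonempty ⟨0, by decide⟩) y =
      gridDist (castGrid e3m2Lo) (castGrid_nonempty ⟨0, by decide⟩) y :=
  halving_eq_of_coincide ⟨0, by decide⟩ ⟨0, by decide⟩ (by decide) (by decide) (by decide) (by decide) e3m2_coincide_hi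
    e3m2_coincide_lo (by exact_mod_cast hly) (by exact_mod_cast hyc)

end Instances

end Summit.Ventures.CertifiedArithmetic.LowPrec.Opt
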